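import Summits.BirchSwinnertonDyer.BirchSwinnertonDyer.Theorems.CyclotomicUntwistPSHalvesOfPSOntoRankZeroHalves
import Summits.BirchSwinnertonDyer.BirchSwinnertonDyer.Theses.KatoDescentPotSupersingular
import Summits.BirchSwinnertonDyer.Rank1Residual.Additive.X4RankZeroKatoBound
import Literature.NumberTheory.EllipticCurves.NonEisensteinPrimeOfSurjective
import HarnessLib

/-!
# Routes `CyclotomicUntwist` / `SemiOrdinaryEisensteinDescent` WITHOUT the wild rank-zero leaf: the LOWER half from
# SOED {E, V, C} + Kato 14.5 (3) (print) + K9's defect crux `WildUpperDefectRankZero` (19197), the UPPER half from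
# SOED Ko + K9's L₀ `WildLowerHalfRankZero` (19195), and the onto wild rank-one LEAF from these — Z eliminated
# in favour of exactly the two K9 rank-zero cruxes each half consumes (cross-route kernels)

Cell `bsd-wall` (W-ALL, row 2 @3), prover seat `bsd-line-cycu-p3` (g0), 2026-08-27. HONEST FRAMING: CONDITIONAL
kernels — every crux / named fact below is an ANTECEDENT (Kato's Thm. 14.5 (3) enters as the tree's named fact
`Kato2004.rankZero_padicValNat_sha_le_of_additive_potGood_of_imageContainsSL2`, i.e. as a hypothesis); closes nothing;
BSD₃ for no curve; 0 definitions, 0 named facts minted, 0 `sorry`.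

SOED's kernel and the companion CU kernels consume the rank-zero wild leaf Z = `WAllExclAddWildRankZero` (SOED item
20387, «RESIDUAL BY NAME — K9's `WildRankZero`») for the Heegner twist `E^{(d_K)}`. Each half needs only the OPPOSITE
half of the twist (`CyclotomicUntwistPSHalvesOfPSOntoRankZeroHalves` §1), and the twist of an onto O6 row is an onto O6
row of analytic rank `0` with the SAME `3`-adic tower (`ontoRow_twist_of_heegner`). On such rows K9 supplies the two
halves SEPARATELY:

* UPPER half of the twist: on the Kato-clean rows (`ρ_{E,3^∞}` onto, `3 ∤ ∏c_ℓ`, a datum with `3 ∤` Manin constant)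
  Kato 2004 Thm. 14.5 (3) (tree consumer `X4RankZero.missingUpperBoundAt_of_kato`, named fact `hKato`, GZK, modularity);
  on the other onto rows EXACTLY K9's crux `WildUpperDefectRankZero` (19197, difficulty L) — its reducible disjunct is
  void for an onto row. §1 `rankZeroUpperHalfOnto_of_kato_of_wildUpperDefectRankZero`.
* LOWER half of the twist: K9's crux `WildLowerHalfRankZero` (19195, L₀; no image binder).

Hence (§2–§4):
* **`lowerHalf_of_soed_of_kato_of_wildUpperDefectRankZero`** — LOWER half on EVERY onto wild rank-one row ⟸ SOED
  {inputs, E, V, C} ∧ `hKato` ∧ K9 19197; **`psRankOneLowerHalfAtThree_of_soed_of_kato_of_wildUpperDefectRankZero`** — CU's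
  K1 BY NAME from these; `…_of_publishedInputsO6_…` — the same with Kato/GZK/modularity taken from K9's support
  `PublishedInputsO6` (19198) by name.
* **`upperHalf_towerRows_of_kolyvaginCrux_of_wildLowerHalfRankZero`** — UPPER half on the tower rows ⟸ SOED {inputs, Ko} ∧
  K9 19195 (no PS binder; the PS-row form is `CyclotomicUntwistPSHalvesOfPSRankZeroHalves` §3).
* **`wAllExclAddWildRankOneSurj_of_soed_of_kato_of_k9RankZeroHalves`** — the LEAF ⟸ SOED {inputs, E, Ko, V, C, NT-upper} ∧
  `hKato` ∧ K9 {19195, 19197}: SOED's Z replaced by the two K9 rank-zero cruxes its halves actually consume (K9's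
  reducible-member machinery, `ReducibleKatoMember` etc., is NOT needed on this onto leaf).

PLANNER-LEVEL READING (bookkeeping, not a ruling): on the onto wild rank-one leaf the rank-zero import is {Kato 14.5 (3)
print, K9 19197 (L), K9 19195 (open-problem)} — not the whole of Z (XL); and CU's K1 needs of K9 only 19197 restricted to
the onto PS rows. BSD is not proved by any of this.

References: [Kato2004Asterisque] Thm. 14.5 (3) (p. 236), (12.5.2) (p. 222), Conj. 12.10; [GrossZagier1986] Thm. I.(6.3),
(7.3), V.§2; [JetchevSkinnerWan2017] §7.4.1 (arXiv:1512.06894 p. 30); [Castella2018] Thm. 2.3, §5; [Jetchev2008] Thm. 1.4;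
[Miller2011LMS] Def. 1.1; [SilvermanAEC2009] X.5 Cor. 5.4; [Zywina2015] Prop. 1.14/1.16.
-/

noncomputable section

open scoped Classical

set_option linter.dupNamespace false
set_option autoImplicit false

namespace Summit.BirchSwinnertonDyer.BirchSwinnertonDyer.Theorems.CyclotomicUntwistOfSOED

open WeierstrassCurve NumberField IsDedekindDomain Field
  Literature.NumberTheory.EllipticCurves
  Literature.NumberTheory.EllipticCurves.ModularForms
  Literature.NumberTheory.EllipticCurves.Rank1Residual
  Literature.NumberTheory.EllipticCurves.Rank1Residual.Typed
  Summit.BirchSwinnertonDyer.Rank1Residual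
  Summit.BirchSwinnertonDyer.Rank1Residual.Additive
  Summit.BirchSwinnertonDyer.Rank1Residual.X11b
  Summit.BirchSwinnertonDyer.BirchSwinnertonDyer.Theses.SemiOrdinaryEisensteinDescent
  Summit.BirchSwinnertonDyer.BirchSwinnertonDyer.Theses.KatoDescentPotSupersingular

/-! ### §0 The minimal Heegner twist of an onto O6 row (no PS binder) -/

/-- **Row data of the minimal Heegner twist of an ONTO O6 row**: non-CM, `ClassO6 Wd 3`, `ρ̄_{Wd,3}` onto, `r_an(Wd) = 0`,
and the `3`-adic tower transports in both spellings (`TowerSurjThree`, and the K9 binder `∀ n, ρ̄_{·,3^n}` onto).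
(`classO6_twist_of_heegner`, `hasCM_iff_of_j_eq`, Zywina, `GaloisImage.hasSurjectiveModNGaloisRep_pow_iff_of_model_twist`.)
[cite: SilvermanAEC2009, X.5 Cor. 5.4] [cite: Zywina2015, Prop. 1.14 and Prop. 1.16] -/
theorem ontoRow_twist_of_heegner (W : WeierstrassCurve ℚ) [W.IsElliptic] [W.IsGloballyMinimal]
    (hO6 : ClassO6 W 3) (hsurj : W.HasSurjectiveModNGaloisRep 3)
    (K : Type) [Field K] [NumberField K] (hK : IsImaginaryQuadratic K) (hodd : Odd (NumberField.discr K))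
    (hHN : SatisfiesHeegnerHypothesis (W.conductorNorm ℤ) K)
    (hLd : (W.quadraticTwist (NumberField.discr K : ℚ)).entireLFunction 1 ≠ 0)
    (Wd : WeierstrassCurve ℚ) [Wd.IsElliptic] [Wd.IsGloballyMinimal] (Cd : VariableChange ℚ)
    (hCd : Cd • W.quadraticTwist (NumberField.discr K : ℚ) = Wd) :
    ¬ Wd.HasCM ∧ ClassO6 Wd 3 ∧ Wd.HasSurjectiveModNGaloisRep 3 ∧ Wd.analyticRank = 0 ∧
      (AdditiveThree.TowerSurjThree Wd ↔ AdditiveThree.TowerSurjThree W) ∧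
      ((∀ n : ℕ, Wd.HasSurjectiveModNGaloisRep (3 ^ n : ℕ)) ↔ (∀ n : ℕ, W.HasSurjectiveModNGaloisRep (3 ^ n : ℕ))) := by
  obtain ⟨hO6d, hjd⟩ := classO6_twist_of_heegner W hO6 K hK hHN hodd Wd Cd hCd
  have hCM : ¬ W.HasCM := fun hCM ↦
    W.not_hasSurjectiveModNGaloisRep_of_hasCM hCM Nat.prime_three (by decide) hsurj
  have hCMd : ¬ Wd.HasCM := fun h ↦ hCM ((hasCM_iff_of_j_eq hjd).mp h)
  have hD0 : (NumberField.discr K : ℚ) ≠ 0 := by exact_mod_cast NumberField.discr_ne_zero K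
  haveI : (W.quadraticTwist (NumberField.discr K : ℚ)).IsElliptic := W.isElliptic_quadraticTwist hD0
  have hLd1 : Wd.entireLFunction 1 ≠ 0 := by rw [← hCd, entireLFunction_smul]; exact hLd
  have hrd : Wd.analyticRank = 0 := analyticRank_eq_zero_of_entireLFunction_one_ne_zero Wd hLd1
  have hlev : ∀ n : ℕ, Wd.HasSurjectiveModNGaloisRep (3 ^ n : ℕ) ↔ W.HasSurjectiveModNGaloisRep (3 ^ n : ℕ) :=
    fun n ↦ GaloisImage.hasSurjectiveModNGaloisRep_pow_iff_of_model_twist W 3 hD0 ⟨Cd, hCd⟩ n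
  have hsurjd : Wd.HasSurjectiveModNGaloisRep 3 := by
    have h := (hlev 1).mpr (by simpa using hsurj)
    simpa using h
  refine ⟨hCMd, hO6d, hsurjd, hrd, ?_, ⟨fun h n ↦ (hlev n).mp (h n), fun h n ↦ (hlev n).mpr (h n)⟩⟩
  unfold AdditiveThree.TowerSurjThree
  exact ⟨fun h n hn ↦ (hlev n).mp (h n hn), fun h n hn ↦ (hlev n).mpr (h n hn)⟩

/-! ### §1 The rank-zero UPPER half on the onto O6 rows: Kato on the clean rows, K9's defect crux on the rest -/

/-- **UPPER half `ord₃ #Ш ≤ ord₃ #Ш_an` on EVERY onto O6 row of analytic rank `0` ⟸ Kato 2004 Thm. 14.5 (3) (named fact,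
hypothesis) ∧ GZK ∧ modularity ∧ K9's crux `WildUpperDefectRankZero` (19197).** Case split on the Kato-clean condition
«`∀ n, ρ̄_{E,3^n}` onto ∧ `3 ∤ ∏c_ℓ` ∧ a datum with `3 ∤` Manin constant»: clean ⟹ `X4RankZero.missingUpperBoundAt_of_kato`
(X4 from O6 + onto ⟹ irreducible; `ord₃ j ≥ 0` from O6); not clean ⟹ 19197, whose reducible disjunct is void (onto ⟹
irreducible). CONDITIONAL. [cite: Kato2004Asterisque, Thm. 14.5 (3) (p. 236) and (12.5.2) (p. 222)]
[cite: Miller2011LMS, Def. 1.1 (arXiv:1010.2431 p. 3)] -/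
theorem rankZeroUpperHalfOnto_of_kato_of_wildUpperDefectRankZero
    (hKato : Kato2004.rankZero_padicValNat_sha_le_of_additive_potGood_of_imageContainsSL2)
    (hGZK : rank_eq_analyticRank_of_analyticRank_le_one) (hmod : hasEntireLFunction_rat)
    (hDef : WildUpperDefectRankZero) :
    ∀ (W : WeierstrassCurve ℚ) [W.IsElliptic] [W.IsGloballyMinimal],
      ClassO6 W 3 → W.HasSurjectiveModNGaloisRep 3 → W.analyticRank = 0 → MissingUpperBoundAt W 3 := by
  intro W _ _ hO6 hsurj hr
  have hirr : W.HasIrreducibleModPGaloisRep 3 :=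
    hasIrreducibleModPGaloisRep_of_hasSurjectiveModNGaloisRep W 3 hsurj
  by_cases hclean : ((∀ n : ℕ, W.HasSurjectiveModNGaloisRep (3 ^ n : ℕ)) ∧ ¬ 3 ∣ W.tamagawaProduct ∧
      ∃ (N : ℕ) (_ : NeZero N) (D : ModularParametrizationData W N), ¬ (3 : ℤ) ∣ D.maninConstant)
  · obtain ⟨htow, htam, N, hN, D, hc⟩ := hclean
    exact X4RankZero.missingUpperBoundAt_of_kato W 3 hKato hGZK hmod hr ⟨by decide, hO6.2.1, hirr⟩
      hO6.padicValRat_j_nonneg htow htam D hc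
  · refine hDef W hr hO6 ?_
    rintro (h | h)
    · exact hclean h
    · exact h.1 hirr

/-! ### §2 The LOWER half on every onto wild rank-one row, Z-free -/

/-- **LOWER half `ord₃ #Ш_an(E) ≤ ord₃ #Ш(E)` on EVERY onto wild rank-one row ⟸ SOED {published inputs, E, V, C} ∧ Kato
14.5 (3) (named fact) ∧ K9's `WildUpperDefectRankZero` (19197).** The row-local kernel
`lowerHalf_row_of_eisenstein_of_waldspurger_of_control_of_twistUpperHalf` with the twist's upper half from §1 at the twist
(an onto O6 row of rank `0`, §0). No wild rank-zero leaf, no tower split. CONDITIONAL; closes nothing.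
[cite: JetchevSkinnerWan2017, §7.4.1 (arXiv:1512.06894 p. 30)] [cite: Castella2018, Thm. 2.3 and §5 (5.1)–(5.3)]
[cite: Kato2004Asterisque, Thm. 14.5 (3) (p. 236)] -/
theorem lowerHalf_of_soed_of_kato_of_wildUpperDefectRankZero (hF : PublishedInputsWildThree)
    (hE : WildSplitEisensteinInclusionAtThree) (hV : WildSplitWaldspurgerAtThree) (hC : WildSplitControlAtThree)
    (hKato : Kato2004.rankZero_padicValNat_sha_le_of_additive_potGood_of_imageContainsSL2)
    (hDef : WildUpperDefectRankZero) :
    ∀ (W : WeierstrassCurve ℚ) [W.IsElliptic] [W.IsGloballyMinimal],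
      ClassO6 W 3 → W.HasSurjectiveModNGaloisRep 3 → W.analyticRank = 1 → MissingLowerBoundAt W 3 := by
  intro W _ _ hO6 hsurj hr
  refine lowerHalf_row_of_eisenstein_of_waldspurger_of_control_of_twistUpperHalf hF hE hV hC W hO6 hsurj hr ?_
  intro K _ _ Wd _ _ Cd hK hodd hHN hLt hCd
  obtain ⟨-, hO6d, hsurjd, hrd, -, -⟩ := ontoRow_twist_of_heegner W hO6 hsurj K hK hodd hHN hLt Wd Cd hCd
  exact rankZeroUpperHalfOnto_of_kato_of_wildUpperDefectRankZero hKato hF.2.2.1 hF.2.2.2.1 hDef Wd hO6d hsurjd hrd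

/-- **CU's deciding crux K1 `PSRankOneLowerHalfAtThree` (21580) ⟸ SOED {inputs, E, V, C} ∧ Kato 14.5 (3) ∧ K9 19197** — the
wild rank-zero leaf Z of the earlier kernels replaced by print + K9's defect crux. CONDITIONAL cross-route kernel; closes
nothing; BSD is not proved by this. [cite: JetchevSkinnerWan2017, §7.4.1 (arXiv:1512.06894 p. 30)]
[cite: Kato2004Asterisque, Thm. 14.5 (3) (p. 236)] -/
theorem psRankOneLowerHalfAtThree_of_soed_of_kato_of_wildUpperDefectRankZero (hF : PublishedInputsWildThree)
    (hE : WildSplitEisensteinInclusionAtThree) (hV : WildSplitWaldspurgerAtThree) (hC : WildSplitControlAtThree)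
    (hKato : Kato2004.rankZero_padicValNat_sha_le_of_additive_potGood_of_imageContainsSL2)
    (hDef : WildUpperDefectRankZero) :
    Summit.BirchSwinnertonDyer.BirchSwinnertonDyer.Theses.CyclotomicUntwist.PSRankOneLowerHalfAtThree := by
  intro W _ _ _hncm hO6 hsurj _hev _hsq hr
  exact lowerHalf_of_soed_of_kato_of_wildUpperDefectRankZero hF hE hV hC hKato hDef W hO6 hsurj hr

/-- **K1 BY NAME from SOED {inputs, E, V, C} and K9 {`PublishedInputsO6` (19198: Kato 14.5 (3), GZK, modularity, …),
`WildUpperDefectRankZero` (19197)}.** CONDITIONAL; closes nothing. [cite: Kato2004Asterisque, Thm. 14.5 (3) (p. 236)]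
[cite: JetchevSkinnerWan2017, §7.4.1 (arXiv:1512.06894 p. 30)] -/
theorem psRankOneLowerHalfAtThree_of_soed_of_publishedInputsO6_of_wildUpperDefectRankZero
    (hF : PublishedInputsWildThree) (hE : WildSplitEisensteinInclusionAtThree) (hV : WildSplitWaldspurgerAtThree)
    (hC : WildSplitControlAtThree) (hP6 : PublishedInputsO6) (hDef : WildUpperDefectRankZero) :
    Summit.BirchSwinnertonDyer.BirchSwinnertonDyer.Theses.CyclotomicUntwist.PSRankOneLowerHalfAtThree :=
  psRankOneLowerHalfAtThree_of_soed_of_kato_of_wildUpperDefectRankZero hF hE hV hC hP6.1 hDef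

/-! ### §3 The UPPER half on the tower rows from Ko and K9's L₀ -/

/-- **UPPER half on the tower-surjective onto wild rank-one rows ⟸ SOED {inputs, Ko} ∧ K9's L₀ `WildLowerHalfRankZero`
(19195)** — L₀ carries no image binder, so it pays the twist's lower half directly. CONDITIONAL.
[cite: JetchevSkinnerWan2017, §7.4.1 (arXiv:1512.06894 p. 30)] [cite: Kato2004Asterisque, Conj. 12.10] -/
theorem upperHalf_towerRows_of_kolyvaginCrux_of_wildLowerHalfRankZero (hF : PublishedInputsWildThree)
    (hKoly : WildKolyvaginUpperAtThree) (hL0 : WildLowerHalfRankZero) :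
    ∀ (W : WeierstrassCurve ℚ) [W.IsElliptic] [W.IsGloballyMinimal],
      ClassO6 W 3 → W.HasSurjectiveModNGaloisRep 3 → AdditiveThree.TowerSurjThree W → W.analyticRank = 1 →
      MissingUpperBoundAt W 3 := by
  intro W _ _ hO6 hsurj htower hr
  refine upperHalf_towerRow_of_kolyvaginCrux_of_twistLowerHalf hF hKoly W hO6 hsurj htower hr ?_
  intro K _ _ Wd _ _ Cd hK hodd hHN hLt hCd
  obtain ⟨-, hO6d, -, hrd, -, -⟩ := ontoRow_twist_of_heegner W hO6 hsurj K hK hodd hHN hLt Wd Cd hCd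
  exact hL0 Wd hrd hO6d

/-! ### §4 The onto wild rank-one LEAF without Z -/

/-- **The leaf `WAllExclAddWildRankOneSurj` ⟸ SOED {published inputs, E, Ko, V, C} ∧ «UPPER half on the non-tower rows» ∧
Kato 14.5 (3) (named fact) ∧ K9 {`WildLowerHalfRankZero` (19195), `WildUpperDefectRankZero` (19197)}.** SOED's rank-zero
antecedent Z = `WAllExclAddWildRankZero` is replaced by exactly the two K9 rank-zero cruxes the halves consume (lower half of
`E` ⟸ E+V+C + [Kato ∨ 19197 at the twist]; upper half ⟸ Ko + [19195 at the twist] on tower rows, the displayed hypothesis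
off them). CONDITIONAL; closes nothing; BSD is not proved by this. [cite: JetchevSkinnerWan2017, §7.4.1 (arXiv:1512.06894 p. 30)]
[cite: Kato2004Asterisque, Thm. 14.5 (3) and Conj. 12.10] [cite: Jetchev2008, Thm. 1.4] -/
theorem wAllExclAddWildRankOneSurj_of_soed_of_kato_of_k9RankZeroHalves (hF : PublishedInputsWildThree)
    (hE : WildSplitEisensteinInclusionAtThree) (hKoly : WildKolyvaginUpperAtThree)
    (hV : WildSplitWaldspurgerAtThree) (hC : WildSplitControlAtThree)
    (hNTu : ∀ (W : WeierstrassCurve ℚ) [W.IsElliptic] [W.IsGloballyMinimal],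
      ¬ W.HasCM → ClassO6 W 3 → W.HasSurjectiveModNGaloisRep 3 → ¬ AdditiveThree.TowerSurjThree W →
      W.analyticRank = 1 → MissingUpperBoundAt W 3)
    (hKato : Kato2004.rankZero_padicValNat_sha_le_of_additive_potGood_of_imageContainsSL2)
    (hL0 : WildLowerHalfRankZero) (hDef : WildUpperDefectRankZero) :
    Summit.BirchSwinnertonDyer.WAllExclAddWildRankOneSurj := by
  intro W _ _ hncm hO6 hsurj hr
  have hGZK : rank_eq_analyticRank_of_analyticRank_le_one := hF.2.2.1
  have hlo : MissingLowerBoundAt W 3 :=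
    lowerHalf_of_soed_of_kato_of_wildUpperDefectRankZero hF hE hV hC hKato hDef W hO6 hsurj hr
  have hup : MissingUpperBoundAt W 3 := by
    by_cases htower : AdditiveThree.TowerSurjThree W
    · exact upperHalf_towerRows_of_kolyvaginCrux_of_wildLowerHalfRankZero hF hKoly hL0 W hO6 hsurj htower hr
    · exact hNTu W hncm hO6 hsurj htower hr
  exact bsdp_of_missingPPartAt W 3 hGZK (by omega) (missingPPartAt_of_lower_of_upper W 3 hlo hup)

/-- The same with SOED's NT (20484) in its filed form and K9's `PublishedInputsO6` (19198) for Kato: **leaf ⟸ SOED {inputs,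
E, Ko, V, C, NT} ∧ K9 {PublishedInputsO6, 19195, 19197}** — every antecedent a route decl, BY NAME. CONDITIONAL.
[cite: JetchevSkinnerWan2017, §7.4.1 (arXiv:1512.06894 p. 30)] [cite: Kato2004Asterisque, Thm. 14.5 (3) and Conj. 12.10] -/
theorem wAllExclAddWildRankOneSurj_of_soed_of_k9 (hF : PublishedInputsWildThree)
    (hE : WildSplitEisensteinInclusionAtThree) (hKoly : WildKolyvaginUpperAtThree)
    (hV : WildSplitWaldspurgerAtThree) (hC : WildSplitControlAtThree) (hNT : WildRankOneSurjNonTowerAtThree)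
    (hP6 : PublishedInputsO6) (hL0 : WildLowerHalfRankZero) (hDef : WildUpperDefectRankZero) :
    Summit.BirchSwinnertonDyer.WAllExclAddWildRankOneSurj := by
  refine wAllExclAddWildRankOneSurj_of_soed_of_kato_of_k9RankZeroHalves hF hE hKoly hV hC ?_ hP6.1 hL0 hDef
  intro W _ _ hncm hO6 hsurj htower hr
  haveI : Finite W.sha := (hF.2.2.1 W (by omega)).2
  exact (lower_and_upper_of_missingPPartAt W 3 (missingPPartAt_of_bsdp W 3 (hNT W hncm hO6 hsurj htower hr))).2

end Summit.BirchSwinnertonDyer.BirchSwinnertonDyer.Theorems.CyclotomicUntwistOfSOED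

end
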